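import Mathlib
import HarnessLib
import Summits.HubbardSuperconductivity.HubbardSuperconductivity.Theorems.KLProgrammeKLRegimeTwoVolumeSrcSectorScaleSuccMinS

/-!
# Route `KLProgramme` — crux K3, VL child `KLRegimeVolumeLimitV17F2` (stmt-HubbardSuperconductivity-20440), blueprint v5 M3b/M5: THE PER-SCALE ONE-VOLUME DATA
# BUNDLES OF THE (vi) SPINE — definitions (seat hubbard-kl-k3c4-p1 g12; `--supports` 20440; definition lane)

`…TwoVolumeSrcSectorScaleSuccMinS.srcSector_sum_norm_kernel_twoVolume_scaleSucc_minS_le` (p590477) reads its one-volume data in six groups.  The M5 composition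
quantifies them over the volume pair `(L, L″ = bL)`, the cutoff `M` and the scale `j`; the M3b-j files DISCHARGE them from the engine's exports (E1's
sub-diagonal read-outs, p3's block Gram / `alphaWt` / sectional rows, p3/p4's overlap masses, `sectorOverlap_blockCovariant`).  To keep both sides readable this
file NAMES the groups as `Prop`-valued structures whose fields are MinS's hypotheses VERBATIM (Λ-scaled site-tnorm currency; `…TwoVolumeDataKitWt` dominates
them by the `klScaleWt` currency):

* `ScaleCovData C Λ κ αW sW` — Gram constant, Λ-scaled weighted rows/columns, entry sup of a sector covariance on `SpaceTimeIdx V M × SectorLeg N`;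
* `ScaleCovSecData C Λ eW` — the SECTIONAL Λ-scaled row (fixed time and label; fine volume only);
* `TransferWtData T ed ed₁ ΛT cW` — Λ_T-scaled weighted rows/columns and block covariance of a block substitution on doubled legs;
* `WtProfileEven W Λ N` / `WtProfileRaw W Λ N` — the `(1 + labelDiam (Λ·tnorm))`-weighted pinned profiles of a doubled-leg Grassmann element, at even
  degrees `2m′` (pin `j`) / at raw degree `k` (pin `p`);
* `KeyedDefectData ed₁ 𝒲′ 𝒲 R RF Ej NDj` — the scale-`j` two-volume data (deep `Ej` within `RF` of every `R`-deep leg, everywhere `NDj`) in MinS's keyed form.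

Definitions only (+ trivial projections); nothing about the model is asserted.  The bundled form of MinS is the sibling `…TwoVolumeSrcSectorScaleSuccBundled`.
-/

noncomputable section

namespace Summit.HubbardSuperconductivity.HubbardSuperconductivity.Theorems.TwoVolumeDefect

set_option linter.dupNamespace false -- summit = problem name (single-conjunct summit), D-0017

open Finset Literature.MathematicalPhysics.QuantumLattice GrassmannAlgebra Literature.Probability.LatticeModels
  Literature.Probability.LatticeModels.BattleFederbush

/-- **`ScaleCovData C Λ κ αW sW`** — one-volume data of a sector covariance `C` on `SpaceTimeIdx V M × SectorLeg N` at rate `Λ`: replica-Gram constant `κ > 0`,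
Λ-scaled weighted rows and columns `≤ αW`, entry sup `≤ sW` (MinS's `hκ hGB hαW hrowW hcolW hsW`). -/
structure ScaleCovData {V M N : ℕ} [NeZero V] (C : Matrix (SpaceTimeIdx V M × SectorLeg N) (SpaceTimeIdx V M × SectorLeg N) ℂ) (Λ κ αW sW : ℝ) : Prop where
  /-- `0 < κ` -/
  κ_pos : 0 < κ
  /-- replica-Gram bound -/
  gram : IsGramBoundedR C κ
  /-- `0 < αW` -/
  αW_pos : 0 < αW
  /-- Λ-scaled weighted rows -/
  row : ∀ X, ∑ Y, ‖C X Y‖ * (1 + Λ * (Torus.tnorm (X.1.2 - Y.1.2) : ℝ)) ≤ αW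
  /-- Λ-scaled weighted columns -/
  col : ∀ Y, ∑ X, ‖C X Y‖ * (1 + Λ * (Torus.tnorm (X.1.2 - Y.1.2) : ℝ)) ≤ αW
  /-- `0 ≤ sW` -/
  sW_nonneg : 0 ≤ sW
  /-- entry sup -/
  entry : ∀ X Y, ‖C X Y‖ ≤ sW

/-- **`ScaleCovSecData C Λ eW`** — the SECTIONAL Λ-scaled row of a sector covariance: at every out-leg, time slice and label, the Λ-weighted sum over the sites
is `≤ eW` (MinS's `hsecW′`; ε-free, unlike the full row). -/
structure ScaleCovSecData {V M N : ℕ} [NeZero V] (C : Matrix (SpaceTimeIdx V M × SectorLeg N) (SpaceTimeIdx V M × SectorLeg N) ℂ) (Λ eW : ℝ) : Prop where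
  /-- sectional Λ-scaled row -/
  sec : ∀ (X : SpaceTimeIdx V M × SectorLeg N) (t : ImagTimeIdx M) (ℓ : SectorLeg N),
    ∑ y : TorusSite 2 V, ‖C X ((t, y), ℓ)‖ * (1 + Λ * (Torus.tnorm (X.1.2 - y) : ℝ)) ≤ eW

/-- **`TransferWtData T ed ed₁ ΛT cW`** — one-volume data of a block substitution `T` between doubled sector-field legs of the fine volume: Λ_T-scaled weighted
rows and columns `≤ cW` and BLOCK COVARIANCE under the doubled block structures (MinS's `hΛT hcW hrowT hcolT hcovT`). -/
structure TransferWtData {b L Lf M N N₁ : ℕ} [NeZero L] [NeZero Lf] (T : Matrix ((SpaceTimeIdx Lf M × SectorLeg N) × Fin 2) ((SpaceTimeIdx Lf M × SectorLeg N₁) × Fin 2) ℂ)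
    (ed : ((SpaceTimeIdx Lf M × SectorLeg N) × Fin 2) ≃ (Fin 2 → Fin b) × ((SpaceTimeIdx L M × SectorLeg N) × Fin 2))
    (ed₁ : ((SpaceTimeIdx Lf M × SectorLeg N₁) × Fin 2) ≃ (Fin 2 → Fin b) × ((SpaceTimeIdx L M × SectorLeg N₁) × Fin 2)) (ΛT cW : ℝ) : Prop where
  /-- `0 ≤ Λ_T` -/
  ΛT_nonneg : 0 ≤ ΛT
  /-- `0 ≤ cW` -/
  cW_nonneg : 0 ≤ cW
  /-- Λ_T-scaled weighted rows -/
  row : ∀ x : (SpaceTimeIdx Lf M × SectorLeg N) × Fin 2, ∑ y', ‖T x y'‖ * (1 + ΛT * (Torus.tnorm (x.1.1.2 - y'.1.1.2) : ℝ)) ≤ cW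
  /-- Λ_T-scaled weighted columns -/
  col : ∀ y' : (SpaceTimeIdx Lf M × SectorLeg N₁) × Fin 2, ∑ x, ‖T x y'‖ * (1 + ΛT * (Torus.tnorm (x.1.1.2 - y'.1.1.2) : ℝ)) ≤ cW
  /-- block covariance -/
  cov : ∀ (δ β' β : Fin 2 → Fin b) (xbar : (SpaceTimeIdx L M × SectorLeg N) × Fin 2) (y : (SpaceTimeIdx L M × SectorLeg N₁) × Fin 2),
    ‖T (ed.symm (β' + δ, xbar)) (ed₁.symm (β + δ, y))‖ = ‖T (ed.symm (β', xbar)) (ed₁.symm (β, y))‖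

/-- **`WtProfileEven W Λ N`** — the `(1 + labelDiam (Λ·tnorm))`-weighted pinned profile of `W` at the even degrees `2m′` is `≤ N m′` (MinS's `hNV/hNW′` shape). -/
structure WtProfileEven {V M Ns : ℕ} [NeZero V] (W : GrassmannAlgebra ℂ ((SpaceTimeIdx V M × SectorLeg Ns) × Fin 2)) (Λ : ℝ) (N : ℕ → ℝ) : Prop where
  /-- `0 ≤ N` -/
  nonneg : ∀ m', 0 ≤ N m'
  /-- weighted pinned profile, even degrees -/
  le : ∀ m' (j : Fin (2 * m')) (x : (SpaceTimeIdx V M × SectorLeg Ns) × Fin 2),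
    ∑ Y ∈ univ.filter (fun Y : Fin (2 * m') → (SpaceTimeIdx V M × SectorLeg Ns) × Fin 2 => Y j = x),
      ‖kernel ℂ W (2 * m') Y‖ *
        (1 + labelDiam (fun Y₁ Y₂ : (SpaceTimeIdx V M × SectorLeg Ns) × Fin 2 => Λ * (Torus.tnorm (Y₁.1.1.2 - Y₂.1.1.2) : ℝ)) (univ.image Y)) ≤ N m'

/-- **`WtProfileRaw W Λ N`** — the same weighted pinned profile at every raw degree `k` and pin `p` (MinS's `hN𝒲` shape; the weighted DB step's output). -/
structure WtProfileRaw {V M Ns : ℕ} [NeZero V] (W : GrassmannAlgebra ℂ ((SpaceTimeIdx V M × SectorLeg Ns) × Fin 2)) (Λ : ℝ) (N : ℕ → ℝ) : Prop where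
  /-- `0 ≤ N` -/
  nonneg : ∀ k, 0 ≤ N k
  /-- weighted pinned profile, raw degree -/
  le : ∀ (k : ℕ) (p : Fin k) (y : (SpaceTimeIdx V M × SectorLeg Ns) × Fin 2),
    ∑ Y ∈ univ.filter (fun Y : Fin k → (SpaceTimeIdx V M × SectorLeg Ns) × Fin 2 => Y p = y),
      ‖kernel ℂ W k Y‖ * (1 + labelDiam (fun Y₁ Y₂ : (SpaceTimeIdx V M × SectorLeg Ns) × Fin 2 => Λ * (Torus.tnorm (Y₁.1.1.2 - Y₂.1.1.2) : ℝ)) (univ.image Y)) ≤ N k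

/-- **`KeyedDefectData ed₁ 𝒲′ 𝒲 R RF Ej NDj`** — the scale-`j` TWO-VOLUME data in MinS's keyed block-reduced form: the deep defect `Ej` (pins within `RF` of an
`R`-deep fine leg) and the everywhere defect `NDj`, at every raw degree and pin (MinS's `hEj0 hNDj0 hEj hNDj`). -/
structure KeyedDefectData {b L Lf M N₁ : ℕ} [NeZero L] [NeZero Lf]
    (ed₁ : ((SpaceTimeIdx Lf M × SectorLeg N₁) × Fin 2) ≃ (Fin 2 → Fin b) × ((SpaceTimeIdx L M × SectorLeg N₁) × Fin 2))
    (𝒲' : GrassmannAlgebra ℂ ((SpaceTimeIdx Lf M × SectorLeg N₁) × Fin 2)) (𝒲 : GrassmannAlgebra ℂ ((SpaceTimeIdx L M × SectorLeg N₁) × Fin 2))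
    (N : ℕ) (R RF : ℕ) (Ej NDj : ℕ → ℝ) : Prop where
  /-- `0 ≤ Ej` -/
  Ej_nonneg : ∀ k, 0 ≤ Ej k
  /-- `0 ≤ NDj` -/
  NDj_nonneg : ∀ k, 0 ≤ NDj k
  /-- deep defect near every `R`-deep leg of the next scale -/
  deep : ∀ x : (SpaceTimeIdx Lf M × SectorLeg N) × Fin 2, (∀ j, R ≤ (x.1.1.2 j).val % L ∧ (x.1.1.2 j).val % L + R < L) →
    ∀ (k : ℕ) (p : Fin k) (y' : (SpaceTimeIdx Lf M × SectorLeg N₁) × Fin 2), Torus.tnorm (x.1.1.2 - y'.1.1.2) ≤ RF →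
      ∑ Y' ∈ univ.filter (fun Y' : Fin k → (SpaceTimeIdx Lf M × SectorLeg N₁) × Fin 2 => Y' p = y'),
        ‖kernel ℂ 𝒲' k Y' - (if ∀ i, (ed₁ (Y' i)).1 = (ed₁ (Y' p)).1 then kernel ℂ 𝒲 k (fun i => (ed₁ (Y' i)).2) else 0)‖ ≤ Ej k
  /-- everywhere defect -/
  everywhere : ∀ (k : ℕ) (p : Fin k) (y' : (SpaceTimeIdx Lf M × SectorLeg N₁) × Fin 2),
    ∑ Y' ∈ univ.filter (fun Y' : Fin k → (SpaceTimeIdx Lf M × SectorLeg N₁) × Fin 2 => Y' p = y'),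
      ‖kernel ℂ 𝒲' k Y' - (if ∀ i, (ed₁ (Y' i)).1 = (ed₁ (Y' p)).1 then kernel ℂ 𝒲 k (fun i => (ed₁ (Y' i)).2) else 0)‖ ≤ NDj k

/-- The everywhere defect dominates the deep one: `KeyedDefectData` with `Ej := NDj`. [folklore] -/
theorem KeyedDefectData.of_everywhere {b L Lf M N₁ : ℕ} [NeZero L] [NeZero Lf]
    {ed₁ : ((SpaceTimeIdx Lf M × SectorLeg N₁) × Fin 2) ≃ (Fin 2 → Fin b) × ((SpaceTimeIdx L M × SectorLeg N₁) × Fin 2)}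
    {𝒲' : GrassmannAlgebra ℂ ((SpaceTimeIdx Lf M × SectorLeg N₁) × Fin 2)} {𝒲 : GrassmannAlgebra ℂ ((SpaceTimeIdx L M × SectorLeg N₁) × Fin 2)}
    {N R RF : ℕ} {NDj : ℕ → ℝ} (h0 : ∀ k, 0 ≤ NDj k)
    (h : ∀ (k : ℕ) (p : Fin k) (y' : (SpaceTimeIdx Lf M × SectorLeg N₁) × Fin 2),
      ∑ Y' ∈ univ.filter (fun Y' : Fin k → (SpaceTimeIdx Lf M × SectorLeg N₁) × Fin 2 => Y' p = y'),
        ‖kernel ℂ 𝒲' k Y' - (if ∀ i, (ed₁ (Y' i)).1 = (ed₁ (Y' p)).1 then kernel ℂ 𝒲 k (fun i => (ed₁ (Y' i)).2) else 0)‖ ≤ NDj k) :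
    KeyedDefectData (N := N) ed₁ 𝒲' 𝒲 R RF NDj NDj :=
  ⟨h0, h0, fun _ _ k p y' _ => h k p y', h⟩

end Summit.HubbardSuperconductivity.HubbardSuperconductivity.Theorems.TwoVolumeDefect

end
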